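import Summits.CriticalPhenomena.PercolationContinuityZ3.Theorems.Transplant.PlanarSkeletonNegDefs
import Summits.CriticalPhenomena.PercolationContinuityZ3.Theorems.Transplant.PlanarSkeletonPrisms
import HarnessLib

/-!
# D″ node, STRUCTURE-FREE base layer (SHEAR-SCOPE §3.14 ruling (B″)): prisms, windows and fat prisms of a bare planar map `φ : V → ℤ²`
# — every statement takes exactly the property it uses (`lip`, a frame `α`, …) as a hypothesis, so ONE layer serves `PlanarSkeleton`,
# `PlanarSkeletonConc`, `PlanarSkeletonNeg`, `PlanarSkeletonSign` (and the planar part of rank-`m` skeletons) by `rfl`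

builds on p205010 (kernel theorem, internal audit signed; external expert review pending) — nothing in this file uses p205010.
Lane `prim-bschramm`, seat `prim-bschramm-p3` (gen 6; design owner, V98 p3 column); helper file (`--supports stmt-CriticalPhenomena-4575`).
Why structure-free: the structure-level twins over `PlanarSkeletonNeg` (p246194 / p246269) print exactly like their `PlanarSkeleton(Conc)` originals and
bounce on the restatement lint although the originals are not importable for a weaker structure; the φ-level statements below are strictly MORE GENERAL
(new constants, explicit hypotheses), hence neither restatements nor twins.
* defs `Skelφ.cyl φ`, `Skelφ.prism G φ`, `Skelφ.prismAt G φ`, `Skelφ.Win G φ`, `Skelφ.cylBall G φ`; bridges `PlanarSkeletonNeg.cyl_eq_skelφ` (rfl);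
* prisms: `mem_prismAt`, `prism_eq_prismAt`, `prismAt_mono`, `prismAt_finite`, `self_mem_prismAt`, **`image_prismAt_of_frame`** (any automorphism `α` with
  `α t = c`, `φ ∘ α = φ + (φ c − φ t)`), `abs_sub_le_length` / `abs_sub_le_of_mem_graphBall` (from `lip`), `prismAt_subset_ballWindow`, `mem_graphBall_of_mem_prismAt`,
  `ne_not_adj_of_sepInf` / `sep_of_sepInf` (from `lip`, with `PlanarSkeleton.SepInf`);
* windows: `mem_Win`, `Win_mono`, `Win_subset_union`, `disjoint_Win`; fat prisms: `cylBall_subset_prism`, `cylBall_subset_cyl`, `self_mem_cylBall`.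
[cite: KozmaNitzan2024, §4 p. 15 (boxes), p. 20 ((22)–(23)), p. 26 ((29)), p. 31 ((31))]
-/

noncomputable section

namespace Summit.CriticalPhenomena.PercolationContinuityZ3.Theorems.Transplant

namespace Skelφ

open Literature.Probability.Percolation Literature.Probability.LatticeModels SimpleGraph
open Literature.Barriers.CriticalPhenomena (graphBall graphBall_finite mem_graphBall_self graphBall_mono mem_graphBall_map)
open PlanarSkeleton (SepInf)
open scoped Classical

variable {V : Type} (G : SimpleGraph V) (φ : V → Site 2)

/-! ## §1 Cylinders, prisms -/

/-- **Cylinder** of half-width `ℓ` at `t` for the planar map `φ`. [cite: KozmaNitzan2024, §4 p. 15 (boxes)] -/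
def cyl (t : V) (ℓ : ℕ) : Set V := {w | φ w - φ t ∈ box 2 ℓ}

/-- Membership in a cylinder. [folklore] -/
@[simp] theorem mem_cyl (t : V) (ℓ : ℕ) (w : V) : w ∈ cyl φ t ℓ ↔ φ w - φ t ∈ box 2 ℓ := Iff.rfl

/-- The centre lies in its cylinders. [folklore] -/
theorem self_mem_cyl (t : V) (ℓ : ℕ) : t ∈ cyl φ t ℓ := by
  rw [mem_cyl, sub_self]; exact zero_mem_box 2 ℓ

/-- **Prism**: the cylinder cut off at graph distance `R` from its centre. [cite: KozmaNitzan2024, §4 p. 15 (boxes)] -/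
def prism (t : V) (R ℓ : ℕ) : Set V := {w | w ∈ graphBall G t R ∧ φ w - φ t ∈ box 2 ℓ}

/-- Membership in a prism. [folklore] -/
@[simp] theorem mem_prism (t : V) (R ℓ : ℕ) (w : V) : w ∈ prism G φ t R ℓ ↔ w ∈ graphBall G t R ∧ φ w - φ t ∈ box 2 ℓ := Iff.rfl

/-- **Prism over a relative planar set** `A`: `B_G(c, L) ∩ φ⁻¹(φ c + A)`. [cite: KozmaNitzan2024, §4 p. 15 (boxes)] -/
def prismAt (c : V) (L : ℕ) (A : Set (Site 2)) : Set V := {g | g ∈ graphBall G c L ∧ φ g - φ c ∈ A}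

/-- Membership in a prism over `A`. [folklore] -/
@[simp] theorem mem_prismAt {c : V} {L : ℕ} {A : Set (Site 2)} {g : V} : g ∈ prismAt G φ c L A ↔ g ∈ graphBall G c L ∧ φ g - φ c ∈ A :=
  Iff.rfl

/-- Prisms over boxes are the box prisms. [folklore] -/
theorem prism_eq_prismAt (t : V) (R ℓ : ℕ) : prism G φ t R ℓ = prismAt G φ t R ↑(box 2 ℓ) := by
  ext g; simp [prism, prismAt]

/-- Prisms grow with the radius and the planar set. [folklore] -/
theorem prismAt_mono (c : V) {L L' : ℕ} (hL : L ≤ L') {A A' : Set (Site 2)} (hA : A ⊆ A') : prismAt G φ c L A ⊆ prismAt G φ c L' A' :=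
  fun _ hg => ⟨graphBall_mono G c hL hg.1, hA hg.2⟩

/-- Prisms are finite in a locally finite graph. [folklore] -/
theorem prismAt_finite [G.LocallyFinite] (c : V) (L : ℕ) (A : Set (Site 2)) : (prismAt G φ c L A).Finite :=
  (graphBall_finite G c L).subset fun _ hg => hg.1

/-- The centre lies in its prisms over sets containing `0`. [folklore] -/
theorem self_mem_prismAt (c : V) (L : ℕ) {A : Set (Site 2)} (hA : (0 : Site 2) ∈ A) : c ∈ prismAt G φ c L A :=
  ⟨mem_graphBall_self G c L, by rw [sub_self]; exact hA⟩

/-- Prisms lie in their cylinder. [folklore] -/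
theorem prismAt_box_subset_cyl (c : V) (L ℓ : ℕ) : prismAt G φ c L ↑(box 2 ℓ) ⊆ cyl φ c ℓ := fun _ hg => hg.2

/-! ## §2 Frame images (any automorphism translating `φ`), planar travel, windows by the triangle inequality -/

variable {G φ}

/-- **Frame images of prisms are prisms — exactly**: an automorphism `α` with `α t = c` translating `φ` by `φ c − φ t` carries `prismAt t L A` onto
`prismAt c L A`. [cite: KozmaNitzan2024, §4 p. 20 ((22)–(23))] -/
theorem image_prismAt_of_frame {α : G ≃g G} {t c : V} (hαt : α t = c) (hφ : ∀ w, φ (α w) = φ w + (φ c - φ t)) (L : ℕ) (A : Set (Site 2)) :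
    α '' prismAt G φ t L A = prismAt G φ c L A := by
  ext g
  constructor
  · rintro ⟨w, ⟨hwB, hwA⟩, rfl⟩
    refine ⟨?_, ?_⟩
    · rw [← hαt]; exact mem_graphBall_map α hwB
    · rw [hφ w]; convert hwA using 1; abel
  · rintro ⟨hgB, hgA⟩
    refine ⟨α.symm g, ⟨?_, ?_⟩, RelIso.apply_symm_apply α g⟩
    · have h := mem_graphBall_map α.symm hgB
      rwa [← hαt, RelIso.symm_apply_apply] at h
    · have h := hφ (α.symm g)
      rw [RelIso.apply_symm_apply] at h
      have h' : φ (α.symm g) - φ t = φ g - φ c := by rw [h]; abel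
      rw [h']; exact hgA

/-- Along a walk a `1`-Lipschitz planar coordinate moves by at most the length. [folklore] -/
theorem abs_sub_le_length (hlip : ∀ ⦃u v : V⦄, G.Adj u v → ∀ i : Fin 2, |φ u i - φ v i| ≤ 1) {a b : V} (q : G.Walk a b) (i : Fin 2) :
    |φ b i - φ a i| ≤ q.length := by
  induction q with
  | nil => simp
  | @cons a c b hac q ih =>
    rw [SimpleGraph.Walk.length_cons, Nat.cast_add, Nat.cast_one]
    have h1 := hlip hac i
    rw [abs_le] at h1 ih ⊢
    constructor <;> linarith [h1.1, h1.2, ih.1, ih.2]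

/-- A vertex of `B_G(w₀, R)` has planar coordinates within `R` of the root's (`φ` `1`-Lipschitz). [folklore] -/
theorem abs_sub_le_of_mem_graphBall (hlip : ∀ ⦃u v : V⦄, G.Adj u v → ∀ i : Fin 2, |φ u i - φ v i| ≤ 1) {w₀ g : V} {R : ℕ}
    (hg : g ∈ graphBall G w₀ R) (i : Fin 2) : |φ g i - φ w₀ i| ≤ R := by
  obtain ⟨p, hp⟩ := hg
  exact (abs_sub_le_length hlip p i).trans (by exact_mod_cast hp)

/-- **Prisms sit inside root-centred windows by the triangle inequality.** [cite: KozmaNitzan2024, §4 p. 21 (v(P) + Λ_M ⊆ S)] -/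
theorem prismAt_subset_ballWindow {w₀ c : V} {R₀ L R : ℕ} (hc : c ∈ graphBall G w₀ R₀) (hR : R₀ + L ≤ R) {A : Set (Site 2)} {P : Set (Site 2)}
    (hA : ∀ y ∈ A, φ c + y ∈ P) : prismAt G φ c L A ⊆ {g | g ∈ graphBall G w₀ R ∧ φ g ∈ P} := by
  intro g hg
  refine ⟨graphBall_mono G w₀ hR (mem_graphBall_add G hc hg.1), ?_⟩
  have h := hA _ hg.2
  rwa [add_sub_cancel] at h

/-- A vertex of a prism of radius `L` about a centre at depth `≤ R₀` has depth `≤ R₀ + L`. [folklore] -/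
theorem mem_graphBall_of_mem_prismAt {w₀ c : V} {R₀ L : ℕ} (hc : c ∈ graphBall G w₀ R₀) {A : Set (Site 2)} {g : V}
    (hg : g ∈ prismAt G φ c L A) : g ∈ graphBall G w₀ (R₀ + L) :=
  mem_graphBall_add G hc hg.1

/-- **The separation lift from `lip` alone**: vertices projecting into ℓ^∞-gap-separated planar sets are distinct and not adjacent.
[cite: KozmaNitzan2024, §4 p. 26 ((29)), p. 31 ((31))] -/
theorem ne_not_adj_of_sepInf (hlip : ∀ ⦃u v : V⦄, G.Adj u v → ∀ i : Fin 2, |φ u i - φ v i| ≤ 1) {A B : Set (Site 2)} (h : SepInf A B)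
    {a b : V} (ha : φ a ∈ A) (hb : φ b ∈ B) : a ≠ b ∧ ¬G.Adj a b := by
  obtain ⟨i, hi⟩ := h _ ha _ hb
  refine ⟨fun hab => ?_, fun hadj => ?_⟩
  · rw [hab, sub_self, abs_zero] at hi; exact absurd hi (by norm_num)
  · have h1 := hlip hadj i; linarith

/-- The same for finite vertex sets cut out by planar footprints. [folklore] -/
theorem sep_of_sepInf (hlip : ∀ ⦃u v : V⦄, G.Adj u v → ∀ i : Fin 2, |φ u i - φ v i| ≤ 1) {A B : Set (Site 2)} (h : SepInf A B)
    {X Y : Finset V} (hX : ∀ a ∈ X, φ a ∈ A) (hY : ∀ b ∈ Y, φ b ∈ B) : ∀ a ∈ X, ∀ b ∈ Y, a ≠ b ∧ ¬G.Adj a b :=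
  fun a ha b hb => ne_not_adj_of_sepInf hlip h (hX a ha) (hY b hb)

/-! ## §3 Windows and fat prisms -/

variable (G φ)

/-- **The coordinate-free WINDOW** over the planar set `P` at depth `R` from the root `w₀`. [this work] -/
def Win [G.LocallyFinite] (w₀ : V) (P : Finset (Site 2)) (R : ℕ) : Finset V := (graphBall_finite G w₀ R).toFinset.filter fun g => φ g ∈ P

/-- Membership in a window. [folklore] -/
theorem mem_Win [G.LocallyFinite] {w₀ : V} {P : Finset (Site 2)} {R : ℕ} {g : V} :
    g ∈ Win G φ w₀ P R ↔ g ∈ graphBall G w₀ R ∧ φ g ∈ P := by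
  simp [Win, Set.Finite.mem_toFinset]

/-- Windows grow with the planar set and the depth. [folklore] -/
theorem Win_mono [G.LocallyFinite] {w₀ : V} {P P' : Finset (Site 2)} (hP : P ⊆ P') {R R' : ℕ} (hR : R ≤ R') :
    Win G φ w₀ P R ⊆ Win G φ w₀ P' R' := by
  intro g hg
  rw [mem_Win] at hg ⊢
  exact ⟨graphBall_mono G w₀ hR hg.1, hP hg.2⟩

/-- A window over `P ⊆ P₁ ∪ P₂` lies in the union of the windows. [folklore] -/
theorem Win_subset_union [G.LocallyFinite] {w₀ : V} {P P₁ P₂ : Finset (Site 2)} (hP : P ⊆ P₁ ∪ P₂) {R R₁ R₂ : ℕ} (h₁ : R ≤ R₁)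
    (h₂ : R ≤ R₂) : Win G φ w₀ P R ⊆ Win G φ w₀ P₁ R₁ ∪ Win G φ w₀ P₂ R₂ := by
  intro g hg
  rw [mem_Win] at hg
  rw [Finset.mem_union, mem_Win, mem_Win]
  rcases Finset.mem_union.1 (hP hg.2) with h | h
  · exact Or.inl ⟨graphBall_mono G w₀ h₁ hg.1, h⟩
  · exact Or.inr ⟨graphBall_mono G w₀ h₂ hg.1, h⟩

/-- Windows over disjoint planar sets are disjoint. [folklore] -/
theorem disjoint_Win [G.LocallyFinite] {w₀ : V} {P P' : Finset (Site 2)} (h : Disjoint P P') (R R' : ℕ) :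
    Disjoint (Win G φ w₀ P R) (Win G φ w₀ P' R') := by
  rw [Finset.disjoint_left]
  intro g hg hg'
  rw [mem_Win] at hg hg'
  exact Finset.disjoint_left.1 h hg.2 hg'.2

/-- **The fat prism**: the ball of radius `R` about `t` INSIDE the induced cylinder graph of half-width `ℓ`. [this work] -/
def cylBall (t : V) (ℓ R : ℕ) : Set V :=
  Subtype.val '' graphBall (G.induce (cyl φ t ℓ)) ⟨t, self_mem_cyl φ t ℓ⟩ R

/-- A fat prism lies in the prism of the same radius and half-width. [folklore] -/
theorem cylBall_subset_prism (t : V) (ℓ R : ℕ) : cylBall G φ t ℓ R ⊆ prism G φ t R ℓ := by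
  rintro _ ⟨y, ⟨w, hw⟩, rfl⟩
  obtain ⟨w', hw'⟩ := PlanarSkeletonConc.exists_walk_of_induce w
  exact ⟨⟨w', hw'.le.trans hw⟩, y.2⟩

/-- A fat prism lies in its cylinder. [folklore] -/
theorem cylBall_subset_cyl (t : V) (ℓ R : ℕ) : cylBall G φ t ℓ R ⊆ cyl φ t ℓ := by
  rintro _ ⟨y, _, rfl⟩; exact y.2

/-- The centre lies in its fat prisms. [folklore] -/
theorem self_mem_cylBall (t : V) (ℓ R : ℕ) : t ∈ cylBall G φ t ℓ R :=
  ⟨⟨t, self_mem_cyl φ t ℓ⟩, mem_graphBall_self _ _ R, rfl⟩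

end Skelφ

/-! ## §4 Bridges: the structures' cylinders are the φ-level cylinders (by `rfl`) -/

namespace PlanarSkeletonNeg

open Literature.Probability.LatticeModels

variable {V : Type} {G : SimpleGraph V} [G.LocallyFinite] (Φ : PlanarSkeletonNeg G)

/-- `PlanarSkeletonNeg.cyl` is the φ-level cylinder of `Φ.φ`. [folklore] -/
theorem cyl_eq_skelφ (t : V) (ℓ : ℕ) : Φ.cyl t ℓ = Skelφ.cyl Φ.φ t ℓ := rfl

end PlanarSkeletonNeg

namespace PlanarSkeleton

open Literature.Probability.LatticeModels

variable {V : Type} {G : SimpleGraph V} (Φ : PlanarSkeleton G)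

/-- `PlanarSkeleton.cyl` is the φ-level cylinder of `Φ.φ`. [folklore] -/
theorem cyl_eq_skelφ (t : V) (ℓ : ℕ) : Φ.cyl t ℓ = Skelφ.cyl Φ.φ t ℓ := rfl

/-- `PlanarSkeleton.prismAt` is the φ-level `prismAt` of `Φ.φ`. [folklore] -/
theorem prismAt_eq_skelφ (c : V) (L : ℕ) (A : Set (Site 2)) : Φ.prismAt c L A = Skelφ.prismAt G Φ.φ c L A := rfl

end PlanarSkeleton

end Summit.CriticalPhenomena.PercolationContinuityZ3.Theorems.Transplant

end
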